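import Mathlib
import Literature.NumberTheory.DiophantineGeometry.PartitionTableaux
import Literature.NumberTheory.DiophantineGeometry.StandardFillings
import Literature.Computability.AlgebraicComplexity.BLMW11StanleyRectangularCharacterProofs
import Literature.Computability.Complexity.OccurrenceObstructionsIP
import Summits.MatrixMultiplication.MatrixMultiplication.Theorems.SnSubsetDichotomyPolynomialSlackSpechtBranching
import Summits.ValiantsHypothesis.ValiantsHypothesis.Theorems.SymPencilEquivariantSdcNotQPYoungDegreeBoundPrelim
import Summits.ValiantsHypothesis.ValiantsHypothesis.Theorems.MonotoneRestorationMixingScaleSpechtDimLinear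
import HarnessLib

/-!
# Self-conjugate shapes have `f^λ ≥ 2(n - 1)` (`n ≥ 6`)

Helper file (2/3) of the discharge of the named fact
`Literature.RepresentationTheory.FiniteGroups.JamesKerber1981_thm_2_5_15` (minimal degree `n - 1` of the
alternating group), filed for route MonotoneRestoration, crux `OrbitRestorationQP`
(stmt-ValiantsHypothesis-18293), line `mixing-scale` (its input `alternatingProductMixing` is reduced in the
tree to that fact).  In the index-two Clifford theory `𝔄_n ◁ 𝔖_n` an irreducible character `χ^λ` of `𝔖_n`
splits on `𝔄_n` only if `λ = λᵀ`; the two halves then have degree `f^λ / 2`, and this file supplies the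
bound that keeps them `≥ n - 1`:

* `two_mul_le_syt_of_transpose_eq` — **for every self-conjugate Young diagram `Y` (`Yᵀ = Y`) with
  `|Y| = n ≥ 6` cells, `2(n - 1) ≤ f^Y`** (as `2|Y| ≤ f^Y + 2`).

Proof.  Let `a = rowLen 0 = colLen 0`; then `Y` lies in the `a × a` box (`n ≤ a²`) and contains the hook
`K = (a, 1^{a-1})`, whose `f` is `C(2a-2, a-1)` (`choose_le_syt_hook`, Pascal recursion along the two
corners of a hook), so `f^Y ≥ C(2a-2, a-1)` by monotonicity (`card_stdFilling_mono`).  This settles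
`a ≥ 5` (`C(2a-2,a-1) ≥ 2a² - 2`) and the hooks themselves (`(1,1) ∉ Y`: `n = 2a - 1`, `a ≥ 4`).  For
`a ∈ {3, 4}` with `(1,1) ∈ Y` the near-hook `N = (a, 2, 1^{a-2}) ⊆ Y` has three corners whose removals
are the hook `K` and two shapes covered by the linear bound of `…SpechtDimLinear`, giving
`f^N ≥ C(2a-2,a-1) + 4a - 4 ∈ {14, 32}`; the one remaining shape, the `3 × 3` square (`n = 9`), has
`f = 42` by the hook length formula for rectangles (`numStandardTableaux_rectangle_mul_prod`).

References: G. James, A. Kerber, *The Representation Theory of the Symmetric Group* (1981), 2.5.7 and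
2.5.15; W. Fulton, *Young Tableaux* (1997), §7.2.  Honest framing: pure combinatorics; nothing here bears
on `VP ≠ VNP`.
-/

namespace Summit.ValiantsHypothesis.ValiantsHypothesis.Theorems.OrbitRestorationQPMixingScale.SpechtDim

open Literature.NumberTheory.DiophantineGeometry Literature.RepresentationTheory.FiniteGroups
open Summit.MatrixMultiplication.MatrixMultiplication.Theorems.PolynomialSlack
open Summit.ValiantsHypothesis.ValiantsHypothesis.Theorems.SymPencilEquivariantSdcNotQP.YoungBounds

-- `Summit.ValiantsHypothesis.ValiantsHypothesis.…` is the tree's single-conjunct layout (Sub = Summit).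
set_option linter.dupNamespace false

/-! ## Three corners -/

/-- **Branching inequality, three corners**: `f^{Y ⊖ c} + f^{Y ⊖ c'} + f^{Y ⊖ c''} ≤ f^{Y}` for corners in
three distinct rows. [folklore] -/
theorem add_add_le_syt_of_isCornerRow {Y : YoungDiagram} {r r' r'' : ℕ} (h : Y.rowLen (r + 1) < Y.rowLen r)
    (h' : Y.rowLen (r' + 1) < Y.rowLen r') (h'' : Y.rowLen (r'' + 1) < Y.rowLen r'')
    (h1 : r ≠ r') (h2 : r ≠ r'') (h3 : r' ≠ r'') :
    Nat.card (StdFilling (Y.removeAbove (r, Y.rowLen r - 1)).cells.card (Y.removeAbove (r, Y.rowLen r - 1))) +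
      Nat.card (StdFilling (Y.removeAbove (r', Y.rowLen r' - 1)).cells.card (Y.removeAbove (r', Y.rowLen r' - 1))) +
      Nat.card (StdFilling (Y.removeAbove (r'', Y.rowLen r'' - 1)).cells.card (Y.removeAbove (r'', Y.rowLen r'' - 1)))
      ≤ Nat.card (StdFilling Y.cells.card Y) := by
  classical
  obtain ⟨n, hY⟩ := exists_card_eq_succ_of_isCornerRow h
  have hbranch := StdFilling.card_stdFilling_succ n Y
  have e1 : Nat.card (StdFilling Y.cells.card Y) = Nat.card (StdFilling (n + 1) Y) := by rw [hY]
  have e2 : ∀ {s : ℕ} (hs : Y.rowLen (s + 1) < Y.rowLen s),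
      Nat.card (StdFilling (Y.removeAbove (s, Y.rowLen s - 1)).cells.card (Y.removeAbove (s, Y.rowLen s - 1))) =
        Nat.card (StdFilling n (Y.removeAbove (s, Y.rowLen s - 1))) := fun hs => by
    rw [card_removeAbove_cornerCell hs hY]
  rw [e1, e2 h, e2 h', e2 h'', hbranch]
  have hc12 : (r, Y.rowLen r - 1) ≠ (r', Y.rowLen r' - 1) := fun e => h1 (congrArg Prod.fst e)
  have hc13 : (r, Y.rowLen r - 1) ≠ (r'', Y.rowLen r'' - 1) := fun e => h2 (congrArg Prod.fst e)
  have hc23 : (r', Y.rowLen r' - 1) ≠ (r'', Y.rowLen r'' - 1) := fun e => h3 (congrArg Prod.fst e)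
  have hsub : ({(r, Y.rowLen r - 1), (r', Y.rowLen r' - 1), (r'', Y.rowLen r'' - 1)} : Finset (ℕ × ℕ)) ⊆ Y.cells := by
    intro c hc
    simp only [Finset.mem_insert, Finset.mem_singleton] at hc
    rcases hc with rfl | rfl | rfl
    · exact cornerCell_mem h
    · exact cornerCell_mem h'
    · exact cornerCell_mem h''
  calc Nat.card (StdFilling n (Y.removeAbove (r, Y.rowLen r - 1))) +
        Nat.card (StdFilling n (Y.removeAbove (r', Y.rowLen r' - 1))) +
        Nat.card (StdFilling n (Y.removeAbove (r'', Y.rowLen r'' - 1)))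
      = ∑ c ∈ ({(r, Y.rowLen r - 1), (r', Y.rowLen r' - 1), (r'', Y.rowLen r'' - 1)} : Finset (ℕ × ℕ)),
          Nat.card (StdFilling n (Y.removeAbove c)) := by
        rw [Finset.sum_insert (by simp [hc12, hc13]), Finset.sum_insert (by simp [hc23]),
          Finset.sum_singleton, add_assoc]
    _ ≤ _ := Finset.sum_le_sum_of_subset_of_nonneg hsub fun _ _ _ => Nat.zero_le _

/-! ## Hooks: `f^{(p, 1^q)} ≥ C(p + q - 1, q)` -/

/-- **The hook count.**  If `Y` is the hook `(p, 1^q)` (`rowLen 0 = p ≥ 1`, rows `1, …, q` of length `1`,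
row `q + 1` empty) then `C(p+q-1, q) ≤ f^Y` (in fact equality; Pascal's rule along the two corners of
the hook). [folklore] -/
theorem choose_le_syt_hook : ∀ (s : ℕ) (Y : YoungDiagram) (p q : ℕ), p + q = s → 1 ≤ p →
    Y.rowLen 0 = p → (∀ r, 1 ≤ r → r ≤ q → Y.rowLen r = 1) → Y.rowLen (q + 1) = 0 →
    (p + q - 1).choose q ≤ Nat.card (StdFilling Y.cells.card Y) := by
  intro s
  induction s with
  | zero => intro Y p q hs hp; omega
  | succ s ih =>
    intro Y p q hs hp h0 hmid hend
    have hf1 := one_le_card_stdFilling Y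
    by_cases hq : q = 0
    · subst hq; simpa using hf1
    by_cases hp1 : p = 1
    · subst hp1; simpa using hf1
    obtain ⟨q', rfl⟩ : ∃ q', q = q' + 1 := ⟨q - 1, by omega⟩
    -- the two corners: row `0` and row `q`
    have hc0 : Y.rowLen (0 + 1) < Y.rowLen 0 := by rw [h0, hmid 1 le_rfl (by omega)]; omega
    have hcq : Y.rowLen (q' + 1 + 1) < Y.rowLen (q' + 1) := by
      rw [hend, hmid (q' + 1) (by omega) le_rfl]; omega
    have hbr := add_le_syt_of_isCornerRow hc0 hcq (by omega)
    -- the child `(p-1, 1^q)`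
    have i0 := ih (Y.removeAbove (0, Y.rowLen 0 - 1)) (p - 1) (q' + 1) (by omega) (by omega)
      (by rw [rowLen_removeAbove_cornerCell_self hc0, h0])
      (fun r hr1 hrq => by rw [rowLen_removeAbove_cornerCell_of_ne hc0 (by omega)]; exact hmid r hr1 hrq)
      (by rw [rowLen_removeAbove_cornerCell_of_ne hc0 (by omega)]; exact hend)
    -- the child `(p, 1^{q-1})`
    have iq := ih (Y.removeAbove (q' + 1, Y.rowLen (q' + 1) - 1)) p q' (by omega) hp
      (by rw [rowLen_removeAbove_cornerCell_of_ne hcq (by omega), h0])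
      (fun r hr1 hrq => by rw [rowLen_removeAbove_cornerCell_of_ne hcq (by omega)]; exact hmid r hr1 (by omega))
      (by rw [rowLen_removeAbove_cornerCell_self hcq, hmid (q' + 1) (by omega) le_rfl])
    have e1 : p - 1 + (q' + 1) - 1 = p + q' - 1 := by omega
    have e2 : p + (q' + 1) - 1 = (p + q' - 1) + 1 := by omega
    rw [e1] at i0
    rw [e2, Nat.choose_succ_succ']
    omega

/-! ## Binomial arithmetic -/

/-- `C(2k, k) ≥ 2k² + 4k` for `k ≥ 4`. [folklore] -/
theorem two_mul_sq_le_centralBinom {k : ℕ} (hk : 4 ≤ k) : 2 * k ^ 2 + 4 * k ≤ Nat.centralBinom k := by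
  induction k with
  | zero => omega
  | succ k ih =>
    rcases Nat.lt_or_ge k 4 with hlt | hge
    · have hk4 : k = 3 := by omega
      subst hk4
      decide
    · have h := Nat.succ_mul_centralBinom_succ k
      have ih' := ih hge
      -- `(k+1) C_{k+1} = 2(2k+1) C_k ≥ 2(k+1) C_k`, so `C_{k+1} ≥ 2 C_k`
      have h2 : (k + 1) * (2 * Nat.centralBinom k) ≤ (k + 1) * Nat.centralBinom (k + 1) := by
        rw [h]; nlinarith [Nat.centralBinom_pos k]
      have h3 : 2 * Nat.centralBinom k ≤ Nat.centralBinom (k + 1) := Nat.le_of_mul_le_mul_left h2 (by omega)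
      nlinarith

/-- `C(2a-2, a-1) ≥ 2a² - 2` for `a ≥ 5` (as `2a² ≤ C + 2`). [folklore] -/
theorem two_mul_sq_le_choose_add_two {a : ℕ} (ha : 5 ≤ a) : 2 * a ^ 2 ≤ (2 * a - 2).choose (a - 1) + 2 := by
  obtain ⟨k, rfl⟩ : ∃ k, a = k + 1 := ⟨a - 1, by omega⟩
  have h := two_mul_sq_le_centralBinom (k := k) (by omega)
  rw [Nat.centralBinom_eq_two_mul_choose] at h
  rw [show 2 * (k + 1) - 2 = 2 * k by omega, show k + 1 - 1 = k by omega]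
  nlinarith

/-! ## The explicit sub-diagrams: the hook `(a, 1^{a-1})` and the near-hook `(a, 2, 1^{a-2})` -/

/-- The hook `K_a = (a, 1^{a-1})` as a Young diagram, with its membership. [folklore] -/
theorem exists_hook_diagram (a : ℕ) :
    ∃ K : YoungDiagram, ∀ c : ℕ × ℕ, c ∈ K ↔ (c.1 = 0 ∧ c.2 < a) ∨ (c.2 = 0 ∧ c.1 < a) := by
  classical
  refine ⟨⟨(Finset.range a).image (fun j => ((0 : ℕ), j)) ∪ (Finset.range a).image (fun i => (i, (0 : ℕ))), ?_⟩, ?_⟩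
  · -- lower set
    intro x y hyx hx
    simp only [Finset.coe_union, Finset.coe_image, Finset.coe_range, Set.mem_union, Set.mem_image,
      Set.mem_Iio] at hx ⊢
    obtain ⟨h1, h2⟩ := Prod.mk_le_mk.1 (show (y.1, y.2) ≤ (x.1, x.2) from hyx)
    rcases hx with ⟨j, hj, hxe⟩ | ⟨i, hi, hxe⟩
    · left; refine ⟨y.2, ?_, ?_⟩
      · rw [← hxe] at h2; simp at h2; omega
      · rw [← hxe] at h1; simp at h1; ext <;> simp [h1]
    · right; refine ⟨y.1, ?_, ?_⟩
      · rw [← hxe] at h1; simp at h1; omega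
      · rw [← hxe] at h2; simp at h2; ext <;> simp [h2]
  · intro c
    show c ∈ (Finset.range a).image (fun j => ((0 : ℕ), j)) ∪ (Finset.range a).image (fun i => (i, (0 : ℕ))) ↔ _
    simp only [Finset.mem_union, Finset.mem_image, Finset.mem_range]
    constructor
    · rintro (⟨j, hj, rfl⟩ | ⟨i, hi, rfl⟩)
      · exact Or.inl ⟨rfl, hj⟩
      · exact Or.inr ⟨rfl, hi⟩
    · rintro (⟨h1, h2⟩ | ⟨h1, h2⟩)
      · exact Or.inl ⟨c.2, h2, by ext <;> simp [h1]⟩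
      · exact Or.inr ⟨c.1, h2, by ext <;> simp [h1]⟩

/-- The near-hook `N_a = (a, 2, 1^{a-2})` (`a ≥ 2`) as a Young diagram, with its membership. [folklore] -/
theorem exists_nearHook_diagram {a : ℕ} (ha : 2 ≤ a) :
    ∃ N : YoungDiagram, ∀ c : ℕ × ℕ, c ∈ N ↔ (c.1 = 0 ∧ c.2 < a) ∨ (c.2 = 0 ∧ c.1 < a) ∨ c = (1, 1) := by
  classical
  obtain ⟨K, hK⟩ := exists_hook_diagram a
  refine ⟨⟨insert ((1 : ℕ), (1 : ℕ)) K.cells, ?_⟩, ?_⟩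
  · intro x y hyx hx
    simp only [Finset.coe_insert, Set.mem_insert_iff, Finset.mem_coe, YoungDiagram.mem_cells] at hx ⊢
    obtain ⟨h1, h2⟩ := Prod.mk_le_mk.1 (show (y.1, y.2) ≤ (x.1, x.2) from hyx)
    rcases hx with hx | hx
    · rw [hx] at h1 h2
      simp at h1 h2
      by_cases hy : y = (1, 1)
      · exact Or.inl hy
      · right
        rw [hK]
        have : y.1 = 0 ∨ y.2 = 0 := by
          by_contra hno
          push Not at hno
          exact hy (Prod.ext (by omega) (by omega))
        rcases this with h | h
        · exact Or.inl ⟨h, by omega⟩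
        · exact Or.inr ⟨h, by omega⟩
    · exact Or.inr (K.isLowerSet hyx hx)
  · intro c
    show c ∈ insert ((1 : ℕ), (1 : ℕ)) K.cells ↔ _
    rw [Finset.mem_insert, YoungDiagram.mem_cells, hK]
    tauto

/-! ## The main estimate -/

/-- **Self-conjugate shapes.**  For every Young diagram `Y` with `Yᵀ = Y` and `|Y| ≥ 6`,
`2(|Y| - 1) ≤ f^Y` (as `2|Y| ≤ f^Y + 2`). [folklore] -/
theorem two_mul_le_syt_of_transpose_eq {Y : YoungDiagram} (hY : Y.transpose = Y) (h6 : 6 ≤ Y.cells.card) :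
    2 * Y.cells.card ≤ Nat.card (StdFilling Y.cells.card Y) + 2 := by
  classical
  set a := Y.rowLen 0 with ha_def
  have hcolY : Y.colLen 0 = a := by rw [← YoungDiagram.rowLen_transpose, hY]
  have hbox : Y.cells.card ≤ a * a := by
    have := card_le_rowLen_mul_colLen Y; rwa [hcolY] at this
  have ha3 : 3 ≤ a := by
    by_contra hlt
    have : a * a ≤ 2 * 2 := Nat.mul_le_mul (by omega) (by omega)
    omega
  -- the hook `K = (a, 1^{a-1}) ⊆ Y`
  obtain ⟨K, hK⟩ := exists_hook_diagram a
  have hKsub : K.cells ⊆ Y.cells := by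
    intro c hc
    rw [YoungDiagram.mem_cells] at hc ⊢
    rcases (hK c).1 hc with ⟨h1, h2⟩ | ⟨h1, h2⟩
    · have : (c.1, c.2) ∈ Y := YoungDiagram.mem_iff_lt_rowLen.2 (by rw [h1]; exact h2)
      simpa using this
    · have : (c.1, c.2) ∈ Y := YoungDiagram.mem_iff_lt_colLen.2 (by rw [h1, hcolY]; exact h2)
      simpa using this
  have hK0 : K.rowLen 0 = a := YoungDiagram.rowLen_eq_of_forall_mem_iff fun j => by
    rw [hK]; simp; omega
  have hKmid : ∀ r, 1 ≤ r → r ≤ a - 1 → K.rowLen r = 1 := fun r hr1 hr2 =>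
    YoungDiagram.rowLen_eq_of_forall_mem_iff fun j => by rw [hK]; simp; omega
  have hKend : K.rowLen (a - 1 + 1) = 0 := YoungDiagram.rowLen_eq_of_forall_mem_iff fun j => by
    rw [hK]; simp; omega
  have hfK : (a + (a - 1) - 1).choose (a - 1) ≤ Nat.card (StdFilling K.cells.card K) :=
    choose_le_syt_hook _ K a (a - 1) rfl (by omega) hK0 hKmid hKend
  rw [show a + (a - 1) - 1 = 2 * a - 2 by omega] at hfK
  have hKY : Nat.card (StdFilling K.cells.card K) ≤ Nat.card (StdFilling Y.cells.card Y) :=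
    card_stdFilling_mono (Y.cells.card - K.cells.card) K Y hKsub (by have := Finset.card_le_card hKsub; omega)
  -- case `a ≥ 5`: the hook suffices
  by_cases ha5 : 5 ≤ a
  · have hb := two_mul_sq_le_choose_add_two ha5
    nlinarith
  -- case `(1,1) ∉ Y`: `Y` is the hook itself, `n ≤ 2a - 1`, and `a = 4`
  by_cases h11 : (1, 1) ∉ Y
  · have hYK : Y.cells ⊆ K.cells := by
      intro c hc
      rw [YoungDiagram.mem_cells] at hc ⊢
      rw [hK]
      have hc1 : c.1 < Y.colLen 0 := YoungDiagram.mem_iff_lt_colLen.1 (by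
        have : (c.1, 0) ≤ (c.1, c.2) := Prod.mk_le_mk.2 ⟨le_rfl, Nat.zero_le _⟩
        exact Y.isLowerSet this hc)
      have hc2 : c.2 < Y.rowLen 0 := YoungDiagram.mem_iff_lt_rowLen.1 (by
        have : (0, c.2) ≤ (c.1, c.2) := Prod.mk_le_mk.2 ⟨Nat.zero_le _, le_rfl⟩
        exact Y.isLowerSet this hc)
      rw [hcolY] at hc1
      by_contra hno
      push Not at hno
      have h1' : c.1 ≠ 0 := fun h => absurd (hno.1 h) (by omega)
      have h2' : c.2 ≠ 0 := fun h => absurd (hno.2 h) (by omega)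
      exact h11 (Y.isLowerSet (Prod.mk_le_mk.2 ⟨Nat.one_le_iff_ne_zero.2 h1', Nat.one_le_iff_ne_zero.2 h2'⟩) hc)
    have hKcard : K.cells.card ≤ a + a - 1 := by
      have hKcells : K.cells ⊆ (Finset.range a).image (fun j => ((0 : ℕ), j)) ∪
          (Finset.range (a - 1)).image (fun i => (i + 1, (0 : ℕ))) := by
        intro c hc
        rw [YoungDiagram.mem_cells, hK] at hc
        simp only [Finset.mem_union, Finset.mem_image, Finset.mem_range]
        rcases hc with ⟨h1, h2⟩ | ⟨h1, h2⟩
        · exact Or.inl ⟨c.2, h2, by ext <;> simp [h1]⟩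
        · by_cases hc0 : c.1 = 0
          · exact Or.inl ⟨c.2, by omega, Prod.ext (by simp [hc0]) rfl⟩
          · exact Or.inr ⟨c.1 - 1, by omega, Prod.ext (by dsimp only; omega) (by simp [h1])⟩
      calc K.cells.card ≤ _ := Finset.card_le_card hKcells
        _ ≤ ((Finset.range a).image (fun j => ((0 : ℕ), j))).card +
              ((Finset.range (a - 1)).image (fun i => (i + 1, (0 : ℕ)))).card := Finset.card_union_le _ _
        _ ≤ a + (a - 1) := by
            gcongr
            · exact (Finset.card_image_le).trans (by simp)
            · exact (Finset.card_image_le).trans (by simp)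
        _ = a + a - 1 := by omega
    have hn : Y.cells.card ≤ 2 * a - 1 := by have := Finset.card_le_card hYK; omega
    have ha4 : a = 4 := by omega
    rw [ha4] at hfK
    have : (2 * 4 - 2).choose (4 - 1) = 20 := by decide
    omega
  -- case `(1,1) ∈ Y`, `a ∈ {3,4}`: the near-hook `N = (a, 2, 1^{a-2}) ⊆ Y`
  push Not at h11
  obtain ⟨N, hN⟩ := exists_nearHook_diagram (a := a) (by omega)
  have hNsub : N.cells ⊆ Y.cells := by
    intro c hc
    rw [YoungDiagram.mem_cells] at hc ⊢
    rcases (hN c).1 hc with h | h | h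
    · exact (YoungDiagram.mem_cells _).1 (hKsub ((YoungDiagram.mem_cells _).2 ((hK c).2 (Or.inl h))))
    · exact (YoungDiagram.mem_cells _).1 (hKsub ((YoungDiagram.mem_cells _).2 ((hK c).2 (Or.inr h))))
    · rw [h]; exact h11
  have hN0 : N.rowLen 0 = a := YoungDiagram.rowLen_eq_of_forall_mem_iff fun j => by
    rw [hN]; simp; omega
  have hN1 : N.rowLen 1 = 2 := YoungDiagram.rowLen_eq_of_forall_mem_iff fun j => by
    rw [hN]; simp; omega
  have hNmid : ∀ r, 2 ≤ r → r < a → N.rowLen r = 1 := fun r hr1 hr2 =>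
    YoungDiagram.rowLen_eq_of_forall_mem_iff fun j => by rw [hN]; simp; omega
  have hNa : N.rowLen a = 0 := YoungDiagram.rowLen_eq_of_forall_mem_iff fun j => by
    rw [hN]; simp; omega
  have hNcol : N.colLen 0 = a := YoungDiagram.colLen_eq_of_forall_mem_iff fun i => by
    rw [hN]; simp; omega
  have hNcard : N.cells.card = 2 * a := by
    rw [card_eq_sum_rowLen, hNcol]
    obtain ⟨b, hb⟩ : ∃ b, a = b + 2 := ⟨a - 2, by omega⟩
    rw [hb, Finset.sum_range_succ', Finset.sum_range_succ']
    rw [Finset.sum_congr rfl fun r hr => hNmid (r + 1 + 1) (by omega) (by have := Finset.mem_range.1 hr; omega)]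
    simp [hN0, hN1]; omega
  -- the three corners of `N`: rows `0`, `1`, `a - 1`
  have hc0 : N.rowLen (0 + 1) < N.rowLen 0 := by rw [hN1, hN0]; omega
  have hc1 : N.rowLen (1 + 1) < N.rowLen 1 := by
    rw [hN1]
    rcases Nat.lt_or_ge 2 a with h | h
    · rw [hNmid 2 le_rfl h]; omega
    · rw [show a = 2 by omega] at hNa; simp only [Nat.reduceAdd]; rw [hNa]; omega
  have hcl : N.rowLen (a - 1 + 1) < N.rowLen (a - 1) := by
    rw [show a - 1 + 1 = a by omega, hNa, hNmid (a - 1) (by omega) (by omega)]; omega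
  have hbr := add_add_le_syt_of_isCornerRow hc0 hc1 hcl (by omega) (by omega) (by omega)
  have hNY : Nat.card (StdFilling N.cells.card N) ≤ Nat.card (StdFilling Y.cells.card Y) :=
    card_stdFilling_mono (Y.cells.card - N.cells.card) N Y hNsub (by have := Finset.card_le_card hNsub; omega)
  -- removal at row `0`: `(a-1, 2, 1^{a-2})`, linear bound
  have hR0c : (N.removeAbove (0, N.rowLen 0 - 1)).cells.card = 2 * a - 1 := by
    rw [card_removeAbove_cornerCell hc0 (n := 2 * a - 1) (by rw [hNcard]; omega)]
  have hR0 := linear_le_syt (Y := N.removeAbove (0, N.rowLen 0 - 1)) (by omega)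
    (by have := rowLen_removeAbove_cornerCell_self hc0; omega)
    (by have := colLen_le_of_le (removeAbove_le N (0, N.rowLen 0 - 1)) 0; omega)
  -- removal at row `1`: the hook `(a, 1^{a-1})`
  have hR1 := choose_le_syt_hook _ (N.removeAbove (1, N.rowLen 1 - 1)) a (a - 1) rfl (by omega)
    (by rw [rowLen_removeAbove_cornerCell_of_ne hc1 (by omega), hN0])
    (fun r hr1 hr2 => by
      by_cases hr : r = 1
      · subst hr; rw [rowLen_removeAbove_cornerCell_self hc1, hN1]
      · rw [rowLen_removeAbove_cornerCell_of_ne hc1 hr]; exact hNmid r (by omega) (by omega))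
    (by rw [rowLen_removeAbove_cornerCell_of_ne hc1 (by omega), show a - 1 + 1 = a by omega, hNa])
  rw [show a + (a - 1) - 1 = 2 * a - 2 by omega] at hR1
  -- removal at row `a - 1`: `(a, 2, 1^{a-3})`, linear bound
  have hRlc : (N.removeAbove (a - 1, N.rowLen (a - 1) - 1)).cells.card = 2 * a - 1 := by
    rw [card_removeAbove_cornerCell hcl (n := 2 * a - 1) (by rw [hNcard]; omega)]
  have hRl := linear_le_syt (Y := N.removeAbove (a - 1, N.rowLen (a - 1) - 1)) (by omega)
    (by have := rowLen_removeAbove_cornerCell_of_ne hcl (i := 0) (by omega); omega)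
    (by have := colLen_le_of_le (removeAbove_le N (a - 1, N.rowLen (a - 1) - 1)) 0; omega)
  -- `a = 4`: `12 + 20 = 32 ≥ 30`; `a = 3`: `8 + 6 = 14` covers `n ≤ 8`
  rcases (show a = 3 ∨ a = 4 by omega) with ha | ha
  · rw [ha] at hR1 hbox
    have e : (2 * 3 - 2).choose (3 - 1) = 6 := by decide
    rw [e] at hR1
    by_cases hn9 : Y.cells.card ≤ 8
    · omega
    · -- `Y` is the `3 × 3` square: `f = 42`
      have hn : Y.cells.card = 9 := by omega
      have hcells : Y.cells = (Nat.Partition.rectangle 3 3).youngDiagram.cells := by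
        apply Finset.eq_of_subset_of_card_le
        · intro c hc
          rw [YoungDiagram.mem_cells] at hc ⊢
          rw [Literature.Computability.Complexity.mem_youngDiagram_rectangle]
          have hc1 : c.1 < Y.colLen c.2 := YoungDiagram.mem_iff_lt_colLen.1 hc
          have hc2 : c.2 < Y.rowLen c.1 := YoungDiagram.mem_iff_lt_rowLen.1 hc
          have := Y.colLen_anti 0 c.2 (Nat.zero_le _)
          have := Y.rowLen_anti 0 c.1 (Nat.zero_le _)
          omega
        · rw [(Nat.Partition.rectangle 3 3).card_cells_youngDiagram, hn]
      have hYeq : Y = (Nat.Partition.rectangle 3 3).youngDiagram := YoungDiagram.ext hcells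
      have h42 := Literature.Computability.AlgebraicComplexity.numStandardTableaux_rectangle_mul_prod 3 3
      rw [numStandardTableaux_eq_card_stdFilling', ← hYeq] at h42
      have hprod : ∏ i ∈ Finset.range 3, ∏ j ∈ Finset.range 3, (i + 1 + (j + 1) - 1) = 8640 := by decide
      have hfact : (3 * 3).factorial = 362880 := by decide
      rw [hprod, hfact] at h42
      omega
  · rw [ha] at hR1 hbox
    have e : (2 * 4 - 2).choose (4 - 1) = 20 := by decide
    rw [e] at hR1
    omega

end Summit.ValiantsHypothesis.ValiantsHypothesis.Theorems.OrbitRestorationQPMixingScale.SpechtDim
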